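import Summits.ResolutionOfSingularities.ResolutionOfSingularities.Theorems.PrimaryDeepAlgebra
import Literature.AlgebraicGeometry.Resolution.QuadraticTransformAlongPrime
import Literature.AlgebraicGeometry.Resolution.RegularWeakTransformPrime
import HarnessLib

/-!
# Primary deep cut — SURFACE CHART (lens-4 g47, node «PrimaryDeepCut», slice S3)

(D1), chart level: for a family `z : Fin (c + 2) → R` (surface equations `z ∘ castAdd 2`, surface parameters
`z_{c+jb}`) the ideals `𝔭 = surfIdeal z`, the surface parameters `c̄ = surfParam z` of `R/𝔭`, the strict-transform
ideal `𝔭' = surfTransformIdeal z jb L` in an algebra `L` over the `z_{c+jb}`-chart, and the chart-level tools: the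
chart of the SURFACE `R/𝔭` hits `L/𝔭'` compatibly (`surfaceChart_hit`) and `L/𝔭'` is a localisation of its image
(`surfaceChart_isLocalization`); §0 is a small factorisation gadget (`liftOfRange`).
-/

set_option linter.dupNamespace false

open CategoryTheory CategoryTheory.Limits AlgebraicGeometry TopologicalSpace IsLocalRing
open MvPolynomial Literature.AlgebraicGeometry.Resolution Scheme.IdealSheafData
open Summit.ResolutionOfSingularities.ResolutionOfSingularities.Theorems
open ForcedTowerClasses DivergentTowerClasses MonomialTowerClasses
open HugDimensionClasses SurfaceShadowClasses SurfaceShadowKernels AbsoluteContactClasses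
open Summit.ResolutionOfSingularities.ResolutionOfSingularities.Theses

universe u

namespace Summit.ResolutionOfSingularities.ResolutionOfSingularities.Theorems.HugValuationCut

/-! ## §0 Factoring a ring map through an injective one -/

section LiftOfRange

variable {A S K : Type*} [CommRing A] [CommRing S] [CommRing K] (f : A →+* K) (ι : S →+* K)
  (hι : Function.Injective ι) (h : ∀ a, f a ∈ ι.range)

/-- A ring map whose values lie in the range of an INJECTIVE ring map `ι` factors through `ι`. [folklore] -/
noncomputable def liftOfRange : A →+* S :=
  (RingEquiv.ofBijective ι.rangeRestrict
      ⟨fun _ _ hab => hι (congrArg Subtype.val hab), RingHom.rangeRestrict_surjective ι⟩).symm.toRingHom.comp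
    (f.codRestrict ι.range h)

/-- `ι ∘ liftOfRange = f`. [folklore] -/
theorem liftOfRange_spec (a : A) : ι (liftOfRange f ι hι h a) = f a := by
  set E := RingEquiv.ofBijective ι.rangeRestrict
      ⟨fun _ _ hab => hι (congrArg Subtype.val hab), RingHom.rangeRestrict_surjective ι⟩ with hE
  have h1 : ((ι.rangeRestrict (E.symm (f.codRestrict ι.range h a)) : ι.range) : K) =
      ((f.codRestrict ι.range h a : ι.range) : K) := by
    rw [show ι.rangeRestrict (E.symm (f.codRestrict ι.range h a)) = E (E.symm (f.codRestrict ι.range h a)) from rfl,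
      E.apply_symm_apply]
  exact h1

end LiftOfRange

/-! ## §1 The surface chart: the ideals `𝔭 = (z_s : s < c)`, `𝔭' = (e_s : s < c)` and chart-level tools -/

section SurfaceChart

variable {R : Type u} [CommRing R] {c : ℕ} (z : Fin (c + 2) → R) (jb : Fin 2)
  (L : Type u) [CommRing L] [Algebra (chartRing z (Fin.natAdd c jb)) L]

/-- `𝔭 = (z_s : s < c)`: the ideal of the hugged regular surface germ. -/
def surfIdeal : Ideal R := Ideal.span (Set.range (z ∘ Fin.castAdd 2))

/-- `c̄ = (z_c, z_{c+1}) mod 𝔭`: the regular system of parameters of the surface `R/𝔭`. -/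
def surfParam : Fin 2 → R ⧸ surfIdeal z := fun i => Ideal.Quotient.mk _ (z (Fin.natAdd c i))

/-- `𝔭' = (e_s : s < c)·L`: the ideal of the strict transform of the surface in a model `L` of the local ring of the
blow-up at a point of the `z_j`-chart, `j = c + jb` a transversal index. -/
def surfTransformIdeal : Ideal L :=
  Ideal.span (Set.range fun s : Fin c =>
    (algebraMap (chartRing z (Fin.natAdd c jb)) L : chartRing z (Fin.natAdd c jb) →+* L)
      (chartGen z (Fin.natAdd c jb) (Fin.castAdd 2 s)))

/-- unfolding `surfIdeal`. [folklore] -/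
theorem surfIdeal_def : surfIdeal z = Ideal.span (Set.range (z ∘ Fin.castAdd 2)) := rfl

/-- unfolding `surfTransformIdeal`. [folklore] -/
theorem surfTransformIdeal_def : surfTransformIdeal z jb L = Ideal.span (Set.range fun s : Fin c =>
    (algebraMap (chartRing z (Fin.natAdd c jb)) L : chartRing z (Fin.natAdd c jb) →+* L)
      (chartGen z (Fin.natAdd c jb) (Fin.castAdd 2 s))) := rfl

/-- a surface-parameter index `c + jb` is not a surface-equation index `< c`. [folklore] -/
theorem natAdd_not_mem_range_castAdd : Fin.natAdd c jb ∉ Set.range (Fin.castAdd 2 : Fin c → Fin (c + 2)) := by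
  rintro ⟨s, hs⟩
  have h := congrArg Fin.val hs
  simp only [Fin.val_castAdd, Fin.val_natAdd] at h
  omega

/-- units modulo an ideal inside the maximal ideal come from units. [folklore] -/
theorem mk_mem_maximalIdeal_iff_of_le [IsLocalRing L] {I : Ideal L} [IsLocalRing (L ⧸ I)] (hI : I ≤ maximalIdeal L) (x : L) :
    Ideal.Quotient.mk I x ∈ maximalIdeal (L ⧸ I) ↔ x ∈ maximalIdeal L := by
  constructor
  · intro h
    by_contra hx
    have hu : IsUnit x := not_not.mp fun h' => hx ((IsLocalRing.mem_maximalIdeal _).mpr (mem_nonunits_iff.mpr h'))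
    exact ((IsLocalRing.mem_maximalIdeal _).mp h) (hu.map (Ideal.Quotient.mk I))
  · intro h
    rw [IsLocalRing.mem_maximalIdeal, mem_nonunits_iff]
    intro hu
    obtain ⟨y, hy⟩ := hu.exists_right_inv
    obtain ⟨y, rfl⟩ := Ideal.Quotient.mk_surjective y
    rw [← map_mul, ← map_one (Ideal.Quotient.mk I), Ideal.Quotient.eq] at hy
    have h1 : (1 : L) ∈ maximalIdeal L := by
      have h2 : x * y - (x * y - 1) = 1 := by ring
      rw [← h2]
      exact Ideal.sub_mem _ (Ideal.mul_mem_right _ _ h) (hI hy)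
    exact (maximalIdeal.isMaximal L).ne_top (Ideal.eq_top_of_isUnit_mem _ h1 isUnit_one)

/-- `σ(𝔭) ⊆ 𝔭'`: the structure map of the blow-up chart sends the surface ideal into the strict-transform ideal
(`φ(z_s) = φ(z_j)·e_s`). [cite: HerrmannIkedaOrbanz1988, Thm. (30.2)] -/
theorem surfIdeal_le_comap :
    surfIdeal z ≤ (surfTransformIdeal z jb L).comap
      ((algebraMap (chartRing z (Fin.natAdd c jb)) L : chartRing z (Fin.natAdd c jb) →+* L).comp
        (chartBase z (Fin.natAdd c jb))) := by
  rw [surfIdeal_def, Ideal.span_le]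
  rintro _ ⟨s, rfl⟩
  rw [SetLike.mem_coe, Ideal.mem_comap, RingHom.comp_apply, Function.comp_apply,
    reesChartBase_apply_eq_mul_chartGen z (Fin.natAdd c jb) (Fin.castAdd 2 s), map_mul, surfTransformIdeal_def]
  exact Ideal.mul_mem_left _ _
    (Ideal.subset_span (s := Set.range fun s : Fin c =>
      (algebraMap (chartRing z (Fin.natAdd c jb)) L : chartRing z (Fin.natAdd c jb) →+* L)
        (chartGen z (Fin.natAdd c jb) (Fin.castAdd 2 s))) (Set.mem_range_self s))

set_option maxHeartbeats 400000 in -- WRITER NOTE (g16): pre-budgeted (elaboration exceeds 100k = half the tree default; ops-buildfix standing ask)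
/-- Every element of the ambient chart is hit, modulo `𝔭'`, by a map `ψ` compatible with structure maps and chart
generators: `B = R[e_t]`, `ψ(0) = e_s (s < c)`, `ψ(ē_i) = e_{c+i}`. [cite: HerrmannIkedaOrbanz1988, Thm. (30.2)] -/
theorem surfaceChart_hit (ψ : chartRing (surfParam z) jb →+* L ⧸ surfTransformIdeal z jb L)
    (hP1 : ∀ r : R, ψ (chartBase (surfParam z) jb (Ideal.Quotient.mk _ r)) =
      Ideal.Quotient.mk _ ((algebraMap (chartRing z (Fin.natAdd c jb)) L : chartRing z (Fin.natAdd c jb) →+* L)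
        (chartBase z (Fin.natAdd c jb) r)))
    (hP2 : ∀ i : Fin 2, ψ (chartGen (surfParam z) jb i) =
      Ideal.Quotient.mk _ ((algebraMap (chartRing z (Fin.natAdd c jb)) L : chartRing z (Fin.natAdd c jb) →+* L)
        (chartGen z (Fin.natAdd c jb) (Fin.natAdd c i))))
    (b₀ : chartRing z (Fin.natAdd c jb)) :
    ∃ b, ψ b = Ideal.Quotient.mk _
      ((algebraMap (chartRing z (Fin.natAdd c jb)) L : chartRing z (Fin.natAdd c jb) →+* L) b₀) := by
  classical
  have hw : ∀ t : Fin (c + 2),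
      ψ (Fin.append (fun _ : Fin c => (0 : chartRing (surfParam z) jb)) (fun i => chartGen (surfParam z) jb i) t) =
        Ideal.Quotient.mk _ ((algebraMap (chartRing z (Fin.natAdd c jb)) L : chartRing z (Fin.natAdd c jb) →+* L)
          (chartGen z (Fin.natAdd c jb) t)) := by
    intro t
    refine Fin.addCases (fun s => ?_) (fun i => ?_) t
    · rw [Fin.append_left, map_zero, eq_comm, Ideal.Quotient.eq_zero_iff_mem, surfTransformIdeal_def]
      exact Ideal.subset_span (s := Set.range fun s : Fin c =>
        (algebraMap (chartRing z (Fin.natAdd c jb)) L : chartRing z (Fin.natAdd c jb) →+* L)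
          (chartGen z (Fin.natAdd c jb) (Fin.castAdd 2 s))) (Set.mem_range_self s)
    · rw [Fin.append_right, hP2]
  obtain ⟨k, F, -, rfl⟩ := exists_isHomogeneous_eval₂_eq z (Fin.natAdd c jb) b₀
  refine ⟨MvPolynomial.eval₂Hom ((chartBase (surfParam z) jb).comp (Ideal.Quotient.mk _))
    (Fin.append (fun _ : Fin c => (0 : chartRing (surfParam z) jb)) (fun i => chartGen (surfParam z) jb i)) F, ?_⟩
  induction F using MvPolynomial.induction_on with
  | C r => simp only [MvPolynomial.eval₂Hom_C, RingHom.comp_apply, hP1]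
  | add p q hp hq => simp only [map_add, hp, hq]
  | mul_X p t hp => simp only [map_mul, MvPolynomial.eval₂Hom_X', hp, hw]

set_option maxHeartbeats 400000 in -- WRITER NOTE (g16): pre-budgeted (elaboration exceeds 100k = half the tree default; ops-buildfix standing ask)
/-- Localisation criterion for `ψ`: if `ψ : B̄ → L/𝔭'` is injective and hits every element of the ambient chart
modulo `𝔭'`, and `L` is the localisation of the ambient chart at `𝔴`, then `L/𝔭'` is the localisation of `B̄`
at `ψ⁻¹(𝔪)`. [cite: StacksProject, Tag 0804] -/
theorem surfaceChart_isLocalization (𝔴 : Ideal (chartRing z (Fin.natAdd c jb))) [𝔴.IsPrime]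
    [IsLocalization.AtPrime L 𝔴] [IsLocalRing (L ⧸ surfTransformIdeal z jb L)]
    (ψ : chartRing (surfParam z) jb →+* L ⧸ surfTransformIdeal z jb L) (hP3 : Function.Injective ψ)
    (hhit : ∀ b₀ : chartRing z (Fin.natAdd c jb), ∃ b, ψ b = Ideal.Quotient.mk _
      ((algebraMap (chartRing z (Fin.natAdd c jb)) L : chartRing z (Fin.natAdd c jb) →+* L) b₀)) :
    @IsLocalization.AtPrime _ _ (L ⧸ surfTransformIdeal z jb L) _ ψ.toAlgebra
      ((maximalIdeal (L ⧸ surfTransformIdeal z jb L)).comap ψ) (Ideal.comap_isPrime _ _) := by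
  letI := ψ.toAlgebra
  refine (isLocalization_iff ((maximalIdeal (L ⧸ surfTransformIdeal z jb L)).comap ψ).primeCompl
    (L ⧸ surfTransformIdeal z jb L)).mpr ⟨?_, ?_, ?_⟩
  · rintro ⟨b, hb⟩
    change IsUnit (ψ b)
    by_contra h
    exact hb ((IsLocalRing.mem_maximalIdeal _).mpr (mem_nonunits_iff.mpr h))
  · intro q
    obtain ⟨o, rfl⟩ := Ideal.Quotient.mk_surjective q
    obtain ⟨⟨b₀, ⟨t₀, ht₀⟩⟩, h⟩ := IsLocalization.surj 𝔴.primeCompl o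
    obtain ⟨b, hb⟩ := hhit b₀
    obtain ⟨t, ht⟩ := hhit t₀
    have htu : IsUnit (ψ t) := by rw [ht]; exact (IsLocalization.map_units L ⟨t₀, ht₀⟩).map _
    refine ⟨⟨b, ⟨t, fun hm => ((IsLocalRing.mem_maximalIdeal _).mp hm) htu⟩⟩, ?_⟩
    change Ideal.Quotient.mk _ o * ψ t = ψ b
    rw [ht, hb, ← map_mul]
    exact congrArg _ h
  · intro b₁ b₂ h12
    exact ⟨1, by rw [hP3 h12]⟩

end SurfaceChart

end Summit.ResolutionOfSingularities.ResolutionOfSingularities.Theorems.HugValuationCut
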